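import Mathlib.ModelTheory.Graph
import Mathlib.Data.Finsupp.Basic
import Mathlib.Order.FixedPoints
import Mathlib.Data.Finset.Card
import Mathlib.Data.Fin.VecNotation
import HarnessLib

/-!
# Cohomological `k`-consistency (Ó Conghaile 2022)

Topic `Literature/ModelTheory/FiniteModelTheory`; definition request
`defn-CohomologicallyKConsistent` (route PneNP/DescentTower, crux `CohConsistencyFooledByThreeCol`,
transfer lemma `TransferUnderGadgets`; also the finite-model-theory work of route
PneNP/Descriptive).

Source: A. Ó Conghaile, *Cohomology in Constraint Satisfaction and Structure Isomorphism*,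
MFCS 2022, LIPIcs 241, 75:1–75:16 = arXiv:2206.15253 (section and item numbers below are those of
the arXiv version), §2.2, §3.1, §3.3.1, §4.2, §4.3.1 (Definition 5), Appendix (Observation 22).

## The mathematics

Fix structures `A` (instance) and `B` (template) over a relational signature and `k : ℕ`.
* A `k`-LOCAL (PARTIAL) HOMOMORPHISM is a partial map `s : A ⇀ B` with `|dom s| ≤ k` preserving
  the related tuples inside `dom s` (§3.1). They form a presheaf `𝓗_k(A,B)` on the poset
  `A^{≤k}` of CONTEXTS (`≤ k`-element subsets of `A`, ordered by inclusion):
  `𝓗_k(A,B)(U) = {s | dom s = U}`, with restriction of functions as restriction maps.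
* For a subpresheaf `𝓢 ⊆ 𝓗_k(A,B)` and `s ∈ 𝓢(C)`:
  `Forth(𝓢, s)` :⇔ (`|C| < k` ⇒) `∀ a ∈ A ∃ b ∈ B, s ∪ {(a,b)} ∈ 𝓢` (§2.2, §3.3.1);
  `ℤ𝓢` is the abelian presheaf of formal `ℤ`-linear combinations of local sections,
  `ℤ𝓢(U) = ℤ[𝓢(U)]`, with the linear extension of restriction; a `ℤ`-LINEAR GLOBAL SECTION is a
  compatible family `(r_U ∈ ℤ𝓢(U))_{U ∈ A^{≤k}}`; `ℤext(𝓢, s)` :⇔ some `ℤ`-linear global section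
  has `r_C = 1·s` (§4.2).
* The operator `(·)^{ℤ↓}` keeps exactly the `s ∈ 𝓢(C)` with `Forth(𝓢,s) ∧ ℤext(𝓢,s)`; the
  COHOMOLOGICAL `k`-CONSISTENCY ALGORITHM accepts `(A,B)` iff the greatest fixpoint of this
  operator starting from `𝓗_k(A,B)` is non-empty; notation `A →^ℤ_k B` (§4.3.1, Definition 5).
* Observation 22 (appendix): `A →^ℤ_k B` iff there is a non-empty `S ⊆ Hom_k(A,B)` every element
  of which is `ℤ`-extendable in `S` (ℤ-extendability subsumes `Forth` and downward closure).

## Lean rendering (design choices)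

* A section over the context `U : Finset A` is a function `↥U → B`; a (sub)presheaf is a
  `SectionSystem A B := (U : Finset A) → Set (↥U → B)` (a complete lattice, pointwise `⊆`), the
  restriction maps being `SectionSystem.restrict`.  Contexts are the `U` with `U.card ≤ k`; all
  systems of interest lie below `homSystem L k A B = 𝓗_k(A,B)`, which has NO sections over
  larger finsets (`SectionSystem.IsLocal`), so values of a system above level `k` never matter.
* `ℤ𝓢(U)` is `(↥U → B) →₀ ℤ` with support in `𝓢(U)`; restriction of formal sums is
  `Finsupp.mapDomain (restrict h)`; compatibility is asked for all pairs `D ⊆ U` of contexts,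
  which is equivalent to the paper's `(r_U)|_{U ∩ U'} = (r_{U'})|_{U ∩ U'}` (take `U' = D`, resp.
  restrict both sides to `U ∩ U'`).
* The greatest fixpoint "starting from `S₀`" is `SectionSystem.gfp k S₀ := OrderHom.gfp (const S₀ ⊓
  reduce k)` (Knaster–Tarski: the union of all self-supporting subfamilies of `S₀`); since
  `reduce k` is monotone this is the limit of the paper's iteration `S₀ ⊇ S₀^{ℤ↓} ⊇ …` whenever
  that iteration stabilises (`gfp_eq_iterate_of_eq`), in particular for finite `A`, `B`.
* `CohomologicallyKConsistent L k A B` is Definition 5 verbatim (gfp of `𝓗_k(A,B)` non-empty);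
  `cohomologicallyKConsistent_iff` is the SELF-SUPPORTING-FAMILY characterisation (∃ non-empty
  restriction-closed `S ≤ 𝓗_k(A,B)` with `Forth ∧ ℤext` for all members) and
  `cohomologicallyKConsistent_iff_zext` is Observation 22.  `KConsistent` is plain
  `k`-consistency `A →_k B` in the Kolaitis–Vardi strategy form recalled in §2.2.
* Structures are Mathlib's `FirstOrder.Language.Structure`; only `RelMap` is constrained (the
  source works over finite RELATIONAL signatures; function symbols, if present in `L`, impose no
  condition on partial maps).  For the graph-colouring routes, `graphHomSystem k G H` is the same
  presheaf for simple graphs (partial maps preserving adjacency) and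
  `graphHomSystem_eq_homSystem` / `graphCohomologicallyKConsistent_iff` identify it with the
  model-theoretic one through Mathlib's `SimpleGraph.structure`.

What is NOT here: the polynomial running time (Prop. "efficient"), transitivity (Prop. 6),
the comparison theorems of §5 (cohomological `k`-consistency decides linear equations over finite
rings), and the isomorphism variant `≡^ℤ_k` (Definition 7).
-/

namespace Literature.ModelTheory.FiniteModelTheory

open FirstOrder FirstOrder.Language FirstOrder.Language.Structure

universe u v

/-- A SYSTEM OF LOCAL SECTIONS from `A` to `B` (a sub-presheaf of the presheaf of all partial
maps `A ⇀ B` with finite domain, on the poset of finite subsets of `A`): for every context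
`U : Finset A` a set of sections `↥U → B`.  Ordered pointwise by inclusion (a complete lattice).
This is the ambient type of the subpresheaves `𝓢 ⊆ 𝓗_k(A,B)` of Ó Conghaile.
[cite: OConghaile2022, §3.1] -/
abbrev SectionSystem (A : Type u) (B : Type v) : Type (max u v) :=
  (U : Finset A) → Set (↥U → B)

/-- Coefficient data for `ℤ`-linear sections: for every context `U` a formal `ℤ`-linear
combination of sections over `U`, i.e. an element of the free abelian group `ℤ[↥U → B]`
(`Finsupp`).  The abelian presheaf `ℤ𝓢` of the source is cut out of this by the support
condition in `SectionSystem.IsZLinearSection`. [cite: OConghaile2022, §4.2] -/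
abbrev ZSections (A : Type u) (B : Type v) : Type (max u v) :=
  (U : Finset A) → ((↥U → B) →₀ ℤ)

namespace SectionSystem

variable {A : Type u} {B : Type v}

/-- The restriction map of the presheaf of partial maps: restrict a section over `U` to a
sub-context `D ⊆ U`. [cite: OConghaile2022, §3.1] -/
protected def restrict {D U : Finset A} (h : D ⊆ U) (t : ↥U → B) : ↥D → B :=
  fun x => t ⟨x, h x.2⟩

/-- Unfolding `restrict`. [folklore] -/
@[simp] theorem restrict_apply {D U : Finset A} (h : D ⊆ U) (t : ↥U → B) (x : ↥D) :
    SectionSystem.restrict h t x = t ⟨x, h x.2⟩ := rfl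

/-- Restriction along `U ⊆ U` is the identity (functoriality, identities). [folklore] -/
theorem restrict_self {U : Finset A} (h : U ⊆ U) (t : ↥U → B) :
    SectionSystem.restrict h t = t := rfl

/-- Restriction is functorial (composition). [folklore] -/
theorem restrict_restrict {E D U : Finset A} (h₁ : E ⊆ D) (h₂ : D ⊆ U) (t : ↥U → B) :
    SectionSystem.restrict h₁ (SectionSystem.restrict h₂ t) =
      SectionSystem.restrict (h₁.trans h₂) t :=
  rfl

/-- A system is NON-EMPTY if it has a section over some context (the acceptance condition of the
consistency algorithms). [cite: OConghaile2022, Def. 5] -/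
protected def Nonempty (S : SectionSystem A B) : Prop :=
  ∃ U : Finset A, (S U).Nonempty

/-- A system is `k`-LOCAL if it only has sections over contexts of size `≤ k`, i.e. it lives on
the cover `A^{≤k}`. [cite: OConghaile2022, §3.1] -/
def IsLocal (k : ℕ) (S : SectionSystem A B) : Prop :=
  ∀ ⦃U : Finset A⦄ ⦃s : ↥U → B⦄, s ∈ S U → U.card ≤ k

/-- A system is DOWNWARD CLOSED (is a sub-presheaf) if it is closed under the restriction maps.
[cite: OConghaile2022, §2.2] -/
def IsDownwardClosed (S : SectionSystem A B) : Prop :=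
  ∀ ⦃D U : Finset A⦄ (h : D ⊆ U) ⦃t : ↥U → B⦄, t ∈ S U → SectionSystem.restrict h t ∈ S D

/-- The FORTH property `Forth(𝓢, s)` of a section `s` over the context `C`: if `|C| < k` then for
every `a ∈ A` the section extends inside `𝓢` to the context `C ∪ {a}` (for `a ∈ C` this just says
`s ∈ 𝓢(C)`). [cite: OConghaile2022, §2.2 and §3.3.1] -/
def Forth [DecidableEq A] (k : ℕ) (S : SectionSystem A B) (C : Finset A) (s : ↥C → B) : Prop :=
  C.card < k →
    ∀ a : A, ∃ t ∈ S (insert a C), SectionSystem.restrict (Finset.subset_insert a C) t = s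

/-- `r` is a `ℤ`-LINEAR GLOBAL SECTION of `𝓢` over the cover `A^{≤k}`: every `r_U` is a formal
`ℤ`-combination of sections of `𝓢(U)` (support condition), and the family is compatible with
restriction: `(r_U)|_D = r_D` for all contexts `D ⊆ U`, `|U| ≤ k`, where restriction of formal
sums is the linear extension `Finsupp.mapDomain (restrict h)`. [cite: OConghaile2022, §4.2] -/
def IsZLinearSection (k : ℕ) (S : SectionSystem A B) (r : ZSections A B) : Prop :=
  (∀ (U : Finset A) (t : ↥U → B), r U t ≠ 0 → t ∈ S U) ∧
    ∀ ⦃D U : Finset A⦄ (h : D ⊆ U), U.card ≤ k →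
      Finsupp.mapDomain (SectionSystem.restrict h) (r U) = r D

/-- `ℤ`-EXTENDABILITY `ℤext(𝓢, s)` of a section `s` over the context `C`: there is a `ℤ`-linear
global section `(r_U)_U` of `ℤ𝓢` with `r_C = 1·s`. [cite: OConghaile2022, §4.2] -/
def ZExt (k : ℕ) (S : SectionSystem A B) (C : Finset A) (s : ↥C → B) : Prop :=
  ∃ r : ZSections A B, IsZLinearSection k S r ∧ r C = Finsupp.single s 1

/-- The operator `(·)^{ℤ↓}`: `(reduce k 𝓢)(C)` consists exactly of the `s ∈ 𝓢(C)` satisfying both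
`Forth(𝓢, s)` and `ℤext(𝓢, s)`. [cite: OConghaile2022, §4.3.1] -/
def reduce [DecidableEq A] (k : ℕ) (S : SectionSystem A B) : SectionSystem A B :=
  fun C => {s | s ∈ S C ∧ Forth k S C s ∧ ZExt k S C s}

/-- A system is SELF-SUPPORTING at level `k` if every member has the forth property and is
`ℤ`-extendable inside the system, i.e. it is a post-fixpoint of `(·)^{ℤ↓}`
(`isSelfSupporting_iff_le_reduce`). [cite: OConghaile2022, §4.3.1 and Observation 22] -/
def IsSelfSupporting [DecidableEq A] (k : ℕ) (S : SectionSystem A B) : Prop :=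
  ∀ ⦃C : Finset A⦄ ⦃s : ↥C → B⦄, s ∈ S C → Forth k S C s ∧ ZExt k S C s

/-! ### Monotonicity -/

/-- Locality passes to smaller systems. [folklore] -/
theorem IsLocal.anti {k : ℕ} {S T : SectionSystem A B} (hTS : T ≤ S) (h : IsLocal k S) :
    IsLocal k T :=
  fun _ _ ht => h (hTS _ ht)

/-- `Forth(𝓢, s)` is monotone in `𝓢`. [folklore] -/
theorem Forth.mono [DecidableEq A] {k : ℕ} {S T : SectionSystem A B} (hST : S ≤ T) {C : Finset A}
    {s : ↥C → B} (h : Forth k S C s) : Forth k T C s :=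
  fun hC a => let ⟨t, ht, hts⟩ := h hC a; ⟨t, hST _ ht, hts⟩

/-- A `ℤ`-linear section of `ℤ𝓢` is one of `ℤ𝓣` for `𝓢 ≤ 𝓣`. [folklore] -/
theorem IsZLinearSection.mono {k : ℕ} {S T : SectionSystem A B} (hST : S ≤ T) {r : ZSections A B}
    (h : IsZLinearSection k S r) : IsZLinearSection k T r :=
  ⟨fun U t ht => hST U (h.1 U t ht), h.2⟩

/-- `ℤext(𝓢, s)` is monotone in `𝓢`. [folklore] -/
theorem ZExt.mono {k : ℕ} {S T : SectionSystem A B} (hST : S ≤ T) {C : Finset A} {s : ↥C → B}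
    (h : ZExt k S C s) : ZExt k T C s :=
  let ⟨r, hr, hrC⟩ := h; ⟨r, hr.mono hST, hrC⟩

/-- `(·)^{ℤ↓}` is deflationary. [cite: OConghaile2022, §4.3.1] -/
theorem reduce_le [DecidableEq A] (k : ℕ) (S : SectionSystem A B) : reduce k S ≤ S :=
  fun _ _ hs => hs.1

/-- `(·)^{ℤ↓}` is monotone (so Knaster–Tarski applies). [folklore] -/
theorem reduce_mono [DecidableEq A] (k : ℕ) : Monotone (reduce (A := A) (B := B) k) :=
  fun _ _ hST _ _ hs => ⟨hST _ hs.1, hs.2.1.mono hST, hs.2.2.mono hST⟩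

/-- Self-supporting = post-fixpoint of `(·)^{ℤ↓}`. [folklore] -/
theorem isSelfSupporting_iff_le_reduce [DecidableEq A] {k : ℕ} {S : SectionSystem A B} :
    IsSelfSupporting k S ↔ S ≤ reduce k S :=
  ⟨fun h _ _ hs => ⟨hs, h hs⟩, fun h _ _ hs => (h _ hs).2⟩

/-! ### Consequences of `ℤ`-extendability (Observation 22) -/

/-- A `ℤ`-extendable section over a context restricts into the system: `ℤext` subsumes downward
closure. [cite: OConghaile2022, Observation 22] -/
theorem ZExt.restrict_mem {k : ℕ} {S : SectionSystem A B} {C : Finset A} {s : ↥C → B}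
    (h : ZExt k S C s) (hC : C.card ≤ k) {D : Finset A} (hD : D ⊆ C) :
    SectionSystem.restrict hD s ∈ S D := by
  obtain ⟨r, ⟨hsupp, hcompat⟩, hrC⟩ := h
  apply hsupp
  rw [← hcompat hD hC, hrC, Finsupp.mapDomain_single, Finsupp.single_eq_same]
  exact one_ne_zero

/-- Restrictions of a `ℤ`-extendable section over a context are `ℤ`-extendable (by the same
`ℤ`-linear global section). [cite: OConghaile2022, §4.2] -/
theorem ZExt.restrict {k : ℕ} {S : SectionSystem A B} {C : Finset A} {s : ↥C → B}
    (h : ZExt k S C s) (hC : C.card ≤ k) {D : Finset A} (hD : D ⊆ C) :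
    ZExt k S D (SectionSystem.restrict hD s) := by
  obtain ⟨r, hr, hrC⟩ := h
  exact ⟨r, hr, by rw [← hr.2 hD hC, hrC, Finsupp.mapDomain_single]⟩

/-- `ℤext` subsumes the forth property: if `r_{C ∪ {a}}` restricts to `1·s` then some section over
`C ∪ {a}` with non-zero coefficient extends `s`. [cite: OConghaile2022, Observation 22] -/
theorem ZExt.forth [DecidableEq A] {k : ℕ} {S : SectionSystem A B} {C : Finset A} {s : ↥C → B}
    (h : ZExt k S C s) : Forth k S C s := by
  classical
  intro hC a
  obtain ⟨r, ⟨hsupp, hcompat⟩, hrC⟩ := h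
  have hU : (insert a C).card ≤ k := (Finset.card_insert_le a C).trans (Nat.succ_le_of_lt hC)
  have hs : s ∈ (Finsupp.mapDomain (SectionSystem.restrict (Finset.subset_insert a C))
      (r (insert a C))).support := by
    rw [hcompat (Finset.subset_insert a C) hU, hrC]
    simp
  obtain ⟨t, ht, hts⟩ := Finset.mem_image.mp (Finsupp.mapDomain_support hs)
  exact ⟨t, hsupp _ t (Finsupp.mem_support_iff.mp ht), hts⟩

/-- Observation 22, local form: a system is self-supporting iff all its members are
`ℤ`-extendable in it. [cite: OConghaile2022, Observation 22] -/
theorem isSelfSupporting_iff_zext [DecidableEq A] {k : ℕ} {S : SectionSystem A B} :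
    IsSelfSupporting k S ↔ ∀ ⦃C : Finset A⦄ ⦃s : ↥C → B⦄, s ∈ S C → ZExt k S C s :=
  ⟨fun h _ _ hs => (h hs).2, fun h _ _ hs => ⟨(h hs).forth, h hs⟩⟩

/-- A self-supporting `k`-local system is automatically downward closed (a sub-presheaf).
[cite: OConghaile2022, Observation 22] -/
theorem IsSelfSupporting.isDownwardClosed [DecidableEq A] {k : ℕ} {S : SectionSystem A B}
    (hloc : IsLocal k S) (h : IsSelfSupporting k S) : IsDownwardClosed S :=
  fun _ _ hDU _ ht => (h ht).2.restrict_mem (hloc ht) hDU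

/-! ### The greatest fixpoint -/

section Gfp

variable [DecidableEq A]

/-- `(·)^{ℤ↓}` as a bundled monotone map. [cite: OConghaile2022, §4.3.1] -/
def reduceHom (k : ℕ) : SectionSystem A B →o SectionSystem A B :=
  ⟨reduce k, reduce_mono k⟩

/-- The GREATEST FIXPOINT of `(·)^{ℤ↓}` starting from `S₀`, written `\overline{S₀}^ℤ` in the
source: the largest `T ≤ S₀` with `T = T^{ℤ↓}`, realised as `OrderHom.gfp (const S₀ ⊓ reduce k)`
= the union of all self-supporting subsystems of `S₀` (Knaster–Tarski); it is the limit of the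
iteration `S₀ ⊇ S₀^{ℤ↓} ⊇ S₀^{ℤ↓ℤ↓} ⊇ …` whenever that stabilises (`gfp_eq_iterate_of_eq`).
[cite: OConghaile2022, §4.3.1] -/
def gfp (k : ℕ) (S₀ : SectionSystem A B) : SectionSystem A B :=
  OrderHom.gfp (OrderHom.const (SectionSystem A B) S₀ ⊓ reduceHom k)

variable {k : ℕ} {S₀ T : SectionSystem A B}

/-- The fixpoint equation `gfp = S₀ ⊓ gfp^{ℤ↓}`. [folklore] -/
theorem gfp_eq : gfp k S₀ = S₀ ⊓ reduce k (gfp k S₀) := by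
  have h := (OrderHom.const (SectionSystem A B) S₀ ⊓ reduceHom k).map_gfp
  exact h.symm

/-- The greatest fixpoint lies below the start. [folklore] -/
theorem gfp_le : gfp k S₀ ≤ S₀ :=
  (reduceHom (A := A) (B := B) k).gfp_const_inf_le S₀

/-- The greatest fixpoint is a post-fixpoint of `(·)^{ℤ↓}`. [folklore] -/
theorem gfp_le_reduce_gfp : gfp k S₀ ≤ reduce k (gfp k S₀) :=
  gfp_eq.le.trans inf_le_right

/-- The greatest fixpoint IS a fixpoint of `(·)^{ℤ↓}`. [cite: OConghaile2022, §4.3.1] -/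
theorem reduce_gfp : reduce k (gfp k S₀) = gfp k S₀ :=
  le_antisymm (reduce_le k _) gfp_le_reduce_gfp

/-- The greatest fixpoint is self-supporting. [cite: OConghaile2022, Observation 22] -/
theorem gfp_isSelfSupporting : IsSelfSupporting k (gfp k S₀) :=
  isSelfSupporting_iff_le_reduce.2 gfp_le_reduce_gfp

/-- The greatest fixpoint of a `k`-local start is `k`-local. [folklore] -/
theorem gfp_isLocal (h : IsLocal k S₀) : IsLocal k (gfp k S₀) :=
  h.anti gfp_le

/-- GREATEST: every self-supporting subsystem of `S₀` lies below the greatest fixpoint.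
[cite: OConghaile2022, Observation 22] -/
theorem le_gfp (hT : T ≤ S₀) (h : IsSelfSupporting k T) : T ≤ gfp k S₀ := by
  refine (OrderHom.const (SectionSystem A B) S₀ ⊓ reduceHom k).le_gfp ?_
  change T ≤ S₀ ⊓ reduce k T
  exact le_inf hT (isSelfSupporting_iff_le_reduce.1 h)

/-- Every fixpoint of `(·)^{ℤ↓}` below `S₀` lies below the greatest fixpoint. [folklore] -/
theorem le_gfp_of_reduce_eq (hT : T ≤ S₀) (h : reduce k T = T) : T ≤ gfp k S₀ :=
  le_gfp hT (isSelfSupporting_iff_le_reduce.2 h.ge)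

/-- THE SELF-SUPPORTING-FAMILY CHARACTERISATION: the greatest fixpoint starting from `S₀` is
non-empty iff `S₀` contains a non-empty self-supporting subsystem.
[cite: OConghaile2022, Observation 22] -/
theorem gfp_nonempty_iff :
    (gfp k S₀).Nonempty ↔
      ∃ T : SectionSystem A B, T ≤ S₀ ∧ T.Nonempty ∧ IsSelfSupporting k T :=
  ⟨fun h => ⟨gfp k S₀, gfp_le, h, gfp_isSelfSupporting⟩,
    fun ⟨_, hT, ⟨C, s, hs⟩, hself⟩ => ⟨C, s, le_gfp hT hself _ hs⟩⟩

/-- The iterates `S₀ ⊇ S₀^{ℤ↓} ⊇ …` of the algorithm stay below the start. [folklore] -/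
theorem iterate_reduce_le (n : ℕ) : (reduce k)^[n] S₀ ≤ S₀ := by
  induction n with
  | zero => exact le_rfl
  | succ n ih => rw [Function.iterate_succ_apply']; exact (reduce_le k _).trans ih

/-- The greatest fixpoint lies below every iterate of the algorithm. [folklore] -/
theorem gfp_le_iterate (n : ℕ) : gfp k S₀ ≤ (reduce k)^[n] S₀ := by
  induction n with
  | zero => exact gfp_le
  | succ n ih =>
    rw [Function.iterate_succ_apply']
    exact gfp_le_reduce_gfp.trans (reduce_mono k ih)

/-- When the iteration of `(·)^{ℤ↓}` from `S₀` halts (as it does after at most `|Hom_k(A,B)|`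
rounds for finite structures), it has computed the greatest fixpoint.
[cite: OConghaile2022, §4.3.1 and Appendix (proof of Prop. "efficient")] -/
theorem gfp_eq_iterate_of_eq {n : ℕ} (h : (reduce k)^[n + 1] S₀ = (reduce k)^[n] S₀) :
    gfp k S₀ = (reduce k)^[n] S₀ :=
  le_antisymm (gfp_le_iterate n)
    (le_gfp_of_reduce_eq (iterate_reduce_le n) (by rwa [Function.iterate_succ_apply'] at h))

end Gfp

end SectionSystem

/-! ### Structures: `𝓗_k(A,B)` and Definition 5 -/

section Structures

/-- A PARTIAL HOMOMORPHISM on the context `U`: a map `s : ↥U → B` preserving every related tuple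
lying inside `U` (`RelMap r x → RelMap r (s ∘ x)`).  Only relation symbols are constrained (the
source works over finite relational signatures). [cite: OConghaile2022, §3.1] -/
def IsPartialHom (L : Language) {A : Type u} {B : Type v} [L.Structure A] [L.Structure B]
    {U : Finset A} (s : ↥U → B) : Prop :=
  ∀ ⦃n : ℕ⦄ (r : L.Relations n) (x : Fin n → ↥U), RelMap r (fun i => (x i : A)) → RelMap r (s ∘ x)

/-- The presheaf `𝓗_k(A,B)` of `k`-LOCAL HOMOMORPHISMS: over a context `U` with `|U| ≤ k`, the
partial homomorphisms with domain exactly `U`; nothing over larger finsets.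
[cite: OConghaile2022, §3.1] -/
def homSystem (L : Language) (k : ℕ) (A : Type u) (B : Type v) [L.Structure A] [L.Structure B] :
    SectionSystem A B :=
  fun U => {s | U.card ≤ k ∧ IsPartialHom L s}

/-- `𝓗_k(A,B)` lives on the cover `A^{≤k}`. [cite: OConghaile2022, §3.1] -/
theorem homSystem_isLocal (L : Language) (k : ℕ) (A : Type u) (B : Type v) [L.Structure A]
    [L.Structure B] : (homSystem L k A B).IsLocal k :=
  fun _ _ hs => hs.1

/-- `𝓗_k(A,B)` is a presheaf: restrictions of partial homomorphisms are partial homomorphisms.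
[cite: OConghaile2022, §3.1] -/
theorem homSystem_isDownwardClosed (L : Language) (k : ℕ) (A : Type u) (B : Type v)
    [L.Structure A] [L.Structure B] : (homSystem L k A B).IsDownwardClosed :=
  fun _ _ hDU _ ht =>
    ⟨(Finset.card_le_card hDU).trans ht.1, fun _ r x hx => ht.2 r (fun i => ⟨x i, hDU (x i).2⟩) hx⟩

/-- COHOMOLOGICAL `k`-CONSISTENCY `A →^ℤ_k B` (Ó Conghaile, Definition 5): the greatest fixpoint of
the operator `(·)^{ℤ↓}` (remove `s ∈ 𝓢(C)` unless `Forth(𝓢,s) ∧ ℤext(𝓢,s)`) starting from the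
presheaf `𝓗_k(A,B)` of `k`-local homomorphisms is non-empty.  (`k = 0` is the trivial level —
the empty section supports itself — unless `L` has `0`-ary relation symbols true in `A` and false
in `B`; `CohomologicallyKConsistent.of_hom`: a homomorphism `A → B` makes the pair cohomologically
`k`-consistent for every `k`.) [cite: OConghaile2022, Def. 5] -/
def CohomologicallyKConsistent (L : Language) (k : ℕ) (A : Type u) (B : Type v) [L.Structure A]
    [L.Structure B] [DecidableEq A] : Prop :=
  (SectionSystem.gfp k (homSystem L k A B)).Nonempty

/-- Plain `k`-CONSISTENCY `A →_k B` in the Kolaitis–Vardi strategy form: there is a non-empty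
downward-closed `S ⊆ Hom_k(A,B)` all of whose members have the forth property (equivalently the
`k`-consistency algorithm / the existential `k`-pebble game accepts).
[cite: OConghaile2022, §2.2] -/
def KConsistent (L : Language) (k : ℕ) (A : Type u) (B : Type v) [L.Structure A]
    [L.Structure B] [DecidableEq A] : Prop :=
  ∃ S : SectionSystem A B, S ≤ homSystem L k A B ∧ S.Nonempty ∧ S.IsDownwardClosed ∧
    ∀ ⦃C : Finset A⦄ ⦃s : ↥C → B⦄, s ∈ S C → S.Forth k C s

variable (L : Language) (k : ℕ) (A : Type u) (B : Type v) [L.Structure A] [L.Structure B]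
  [DecidableEq A]

/-- THE SELF-SUPPORTING-FAMILY CHARACTERISATION of Definition 5: `A →^ℤ_k B` iff there is a
non-empty, restriction-closed `S ⊆ 𝓗_k(A,B)` every member of which has the forth property and is
`ℤ`-extendable inside `S`. [cite: OConghaile2022, §4.3.1 and Observation 22] -/
theorem cohomologicallyKConsistent_iff :
    CohomologicallyKConsistent L k A B ↔
      ∃ S : SectionSystem A B, S ≤ homSystem L k A B ∧ S.Nonempty ∧ S.IsDownwardClosed ∧
        ∀ ⦃C : Finset A⦄ ⦃s : ↥C → B⦄, s ∈ S C → S.Forth k C s ∧ S.ZExt k C s := by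
  constructor
  · intro h
    exact ⟨SectionSystem.gfp k (homSystem L k A B), SectionSystem.gfp_le, h,
      SectionSystem.gfp_isSelfSupporting.isDownwardClosed
        (SectionSystem.gfp_isLocal (homSystem_isLocal L k A B)),
      SectionSystem.gfp_isSelfSupporting⟩
  · rintro ⟨S, hS, hne, -, hself⟩
    exact SectionSystem.gfp_nonempty_iff.2 ⟨S, hS, hne, hself⟩

/-- Observation 22: `A →^ℤ_k B` iff some non-empty `S ⊆ Hom_k(A,B)` has every member
`ℤ`-extendable in `S` (forth and downward closure are then automatic).
[cite: OConghaile2022, Observation 22] -/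
theorem cohomologicallyKConsistent_iff_zext :
    CohomologicallyKConsistent L k A B ↔
      ∃ S : SectionSystem A B, S ≤ homSystem L k A B ∧ S.Nonempty ∧
        ∀ ⦃C : Finset A⦄ ⦃s : ↥C → B⦄, s ∈ S C → S.ZExt k C s := by
  rw [cohomologicallyKConsistent_iff]
  constructor
  · rintro ⟨S, hS, hne, -, hself⟩
    exact ⟨S, hS, hne, fun C s hs => (hself hs).2⟩
  · rintro ⟨S, hS, hne, hz⟩
    have hself : S.IsSelfSupporting k := SectionSystem.isSelfSupporting_iff_zext.2 hz
    exact ⟨S, hS, hne, hself.isDownwardClosed ((homSystem_isLocal L k A B).anti hS), hself⟩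

variable {L k A B}

/-- Cohomological `k`-consistency refines `k`-consistency. [cite: OConghaile2022, §4.3.1] -/
theorem CohomologicallyKConsistent.kConsistent (h : CohomologicallyKConsistent L k A B) :
    KConsistent L k A B := by
  obtain ⟨S, hS, hne, hdc, hself⟩ := (cohomologicallyKConsistent_iff L k A B).1 h
  exact ⟨S, hS, hne, hdc, fun C s hs => (hself hs).1⟩

/-- SOUNDNESS (non-vacuity): a global homomorphism `f : A → B` is never refuted — its restrictions
`{f|_U}_{|U| ≤ k}` form a self-supporting family, with `ℤ`-linear sections `r_U = 1·f|_U`.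
[cite: OConghaile2022, §4.3.1 (the gfp has a global section iff `𝓗_k` has one)] -/
theorem CohomologicallyKConsistent.of_hom (f : A →[L] B) :
    CohomologicallyKConsistent L k A B := by
  classical
  let S : SectionSystem A B := fun U => {s | U.card ≤ k ∧ s = f ∘ Subtype.val}
  have hS : S ≤ homSystem L k A B := by
    rintro U s ⟨hU, rfl⟩
    exact ⟨hU, fun n r x hx => f.map_rel r (fun i => (x i : A)) hx⟩
  refine SectionSystem.gfp_nonempty_iff.2 ⟨S, hS, ⟨∅, f ∘ Subtype.val, by simp [S]⟩, ?_⟩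
  rintro C s ⟨hC, rfl⟩
  refine ⟨fun hC' a => ⟨f ∘ Subtype.val,
    ⟨(Finset.card_insert_le a C).trans (Nat.succ_le_of_lt hC'), rfl⟩, rfl⟩, ?_⟩
  refine ⟨fun U => if U.card ≤ k then Finsupp.single (f ∘ Subtype.val) 1 else 0, ⟨?_, ?_⟩, ?_⟩
  · intro U t ht
    dsimp only at ht
    by_cases hU : U.card ≤ k
    · rw [if_pos hU, Finsupp.single_apply] at ht
      split_ifs at ht with hft
      · exact ⟨hU, hft.symm⟩
      · exact (ht rfl).elim
    · rw [if_neg hU] at ht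
      exact (ht rfl).elim
  · intro D U hDU hU
    have hD : D.card ≤ k := (Finset.card_le_card hDU).trans hU
    have hres : SectionSystem.restrict hDU (⇑f ∘ Subtype.val) = (⇑f ∘ Subtype.val : ↥D → B) := rfl
    dsimp only
    rw [if_pos hU, if_pos hD, Finsupp.mapDomain_single, hres]
  · exact if_pos hC

end Structures

/-! ### Simple graphs (the format of the colouring routes) -/

section Graph

variable {V : Type u} {W : Type v}

/-- `𝓗_k(G,H)` for simple graphs: over a context `U ⊆ V` with `|U| ≤ k`, the maps `↥U → W`
sending adjacent vertices of `G` inside `U` to adjacent vertices of `H` (partial graph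
homomorphisms; for `H = K₃ = ⊤ : SimpleGraph (Fin 3)` these are the partial proper
`3`-colourings).  Equal to the model-theoretic `homSystem` for Mathlib's `SimpleGraph.structure`
(`graphHomSystem_eq_homSystem`). [cite: OConghaile2022, §3.1] -/
def graphHomSystem (k : ℕ) (G : SimpleGraph V) (H : SimpleGraph W) : SectionSystem V W :=
  fun U => {s | U.card ≤ k ∧ ∀ u v : ↥U, G.Adj u v → H.Adj (s u) (s v)}

/-- The graph presheaf is the model-theoretic one in the language of graphs.
[cite: OConghaile2022, §3.1] -/
theorem graphHomSystem_eq_homSystem (k : ℕ) (G : SimpleGraph V) (H : SimpleGraph W) :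
    graphHomSystem k G H = @homSystem Language.graph k V W G.structure H.structure := by
  funext U
  ext s
  simp only [graphHomSystem, homSystem, Set.mem_setOf_eq, IsPartialHom]
  refine and_congr_right fun _ => ⟨fun h n r x hx => ?_, fun h u v huv => ?_⟩
  · match n, r with
    | 2, .adj => exact h (x 0) (x 1) hx
  · exact h Language.adj ![u, v] huv

/-- COHOMOLOGICAL `k`-CONSISTENCY OF GRAPHS `G →^ℤ_k H`: Definition 5 for the presheaf of partial
graph homomorphisms (`graphCohomologicallyKConsistent_iff`: it is literally the model-theoretic
notion for `SimpleGraph.structure`).  With `H = ⊤ : SimpleGraph (Fin 3)` this is the level used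
by route PneNP/DescentTower. [cite: OConghaile2022, Def. 5] -/
def GraphCohomologicallyKConsistent [DecidableEq V] (k : ℕ) (G : SimpleGraph V)
    (H : SimpleGraph W) : Prop :=
  (SectionSystem.gfp k (graphHomSystem k G H)).Nonempty

/-- The graph notion is the model-theoretic Definition 5 in the language of graphs.
[cite: OConghaile2022, Def. 5] -/
theorem graphCohomologicallyKConsistent_iff [DecidableEq V] (k : ℕ) (G : SimpleGraph V)
    (H : SimpleGraph W) :
    GraphCohomologicallyKConsistent k G H ↔
      @CohomologicallyKConsistent Language.graph k V W G.structure H.structure _ := by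
  unfold GraphCohomologicallyKConsistent CohomologicallyKConsistent
  rw [graphHomSystem_eq_homSystem]

/-- Plain `k`-CONSISTENCY OF GRAPHS `G →_k H` (strategy form: a non-empty, restriction-closed
family of partial homomorphisms on `≤ k` vertices with the forth property), the graph case of
`KConsistent` (`graphKConsistent_iff`). [cite: OConghaile2022, §2.2] -/
def GraphKConsistent [DecidableEq V] (k : ℕ) (G : SimpleGraph V) (H : SimpleGraph W) : Prop :=
  ∃ S : SectionSystem V W, S ≤ graphHomSystem k G H ∧ S.Nonempty ∧ S.IsDownwardClosed ∧
    ∀ ⦃C : Finset V⦄ ⦃s : ↥C → W⦄, s ∈ S C → S.Forth k C s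

/-- The graph notion of `k`-consistency is the model-theoretic one in the language of graphs.
[cite: OConghaile2022, §2.2] -/
theorem graphKConsistent_iff [DecidableEq V] (k : ℕ) (G : SimpleGraph V) (H : SimpleGraph W) :
    GraphKConsistent k G H ↔ @KConsistent Language.graph k V W G.structure H.structure _ := by
  unfold GraphKConsistent KConsistent
  rw [graphHomSystem_eq_homSystem]

/-- The self-supporting-family characterisation for graphs: `G →^ℤ_k H` iff some non-empty,
restriction-closed family of partial homomorphisms on `≤ k` vertices has forth and
`ℤ`-extendability for all its members. [cite: OConghaile2022, Observation 22] -/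
theorem graphCohomologicallyKConsistent_iff_exists [DecidableEq V] (k : ℕ) (G : SimpleGraph V)
    (H : SimpleGraph W) :
    GraphCohomologicallyKConsistent k G H ↔
      ∃ S : SectionSystem V W, S ≤ graphHomSystem k G H ∧ S.Nonempty ∧ S.IsDownwardClosed ∧
        ∀ ⦃C : Finset V⦄ ⦃s : ↥C → W⦄, s ∈ S C → S.Forth k C s ∧ S.ZExt k C s := by
  rw [graphCohomologicallyKConsistent_iff, graphHomSystem_eq_homSystem]
  exact @cohomologicallyKConsistent_iff Language.graph k V W G.structure H.structure _

/-- Cohomological `k`-consistency of graphs refines `k`-consistency of graphs.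
[cite: OConghaile2022, §4.3.1] -/
theorem GraphCohomologicallyKConsistent.graphKConsistent [DecidableEq V] {k : ℕ}
    {G : SimpleGraph V} {H : SimpleGraph W} (h : GraphCohomologicallyKConsistent k G H) :
    GraphKConsistent k G H := by
  rw [graphKConsistent_iff]
  rw [graphCohomologicallyKConsistent_iff] at h
  exact @CohomologicallyKConsistent.kConsistent Language.graph k V W G.structure H.structure _ h

end Graph

end Literature.ModelTheory.FiniteModelTheory
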